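import Mathlib
import Literature.NumberTheory.LFunctions.Zhang2022.SkeletonPartOne
import Literature.NumberTheory.LFunctions.Zhang2022.Section3Lemma32Subconvex
import HarnessLib

/-!
# Zhang (2022) §3, Lemma 3.2: the skeleton node `Lemma32` DISCHARGED MODULO the critical-line
# size input (campaign FACT F-15, hypothesis form)

Topic `Literature/NumberTheory/LFunctions/Zhang2022` (Landau–Siegel adjudication tree;
verdict-neutral). Y. Zhang, *Discrete mean estimates and the Landau–Siegel zero*,
arXiv:2211.02515v1 (2022) [Zhang2022LandauSiegel], §3, Lemma 3.2 (PDF p. 13, tex L757–L777;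
DAG nodes `Z22:Lem3.2`, `Z22:Lem3.2.pf`):

> **Lemma 3.2.** Assume (A) holds. Then we have `Σ_{D⁴<n≤D⁸} ν(n)²τ₂(n)²/n ≪ 𝓛⁻²⁰⁰⁷`.
> *Proof.* As the situation is analogous to Lemma 3.1 we give a sketch only. It can be verified
> that the function `φ*(s) = ζ(s)⁻⁸L(s,χ)⁻⁸ Σ_n ν(n)²τ₂(n)²n^{−s}` is analytic for `σ > 1/2` and it
> satisfies `φ*(s) ≪ Π_{p∣D}|1 − p^{−4s}|` for `σ ≥ σ₁ > 1/2` […]. Also, one can verify that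
> `∫_{|s|=α*} φ*(1+s)ζ(1+s)⁸L(1+s,χ)⁸(D^{8s} − D^{4s})Γ(s) ds ≪ 𝓛⁻²⁰⁰⁷`. This completes the proof. □

The typed skeleton states the lemma as the CLAIM node `Skeleton.Lemma32` (`SkeletonPartOne.lean`;
the leaf `h32` of the whole-DAG theorem `Skeleton.theorem1_of_leaves`). The tree PROVES the printed
statement under (A) **given** a size bound for `L(s,χ)` of conductor exponent `μ < ¼` on the
critical line (`Lemma32Subconvex.lemma_3_2_of_halfLineBound`, `…_of_burgessShape`, resting on the
contour shift of `Section3Lemma32Conditional` and the Rademacher–Phragmén–Lindelöf interpolation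
of `Section3Lemma32Subconvex`); at convexity strength (`μ = ¼`, the tree's own Pólya–Vinogradov
bound) the printed route gives no saving (`Section3SubconvexInput.not_saves_lemma32_convexity`).
The campaign's frozen fact list registers that input as **FACT F-15 (class H, hypothesis form)** —
q-aspect subconvexity `L(½+it,χ) ≪_ε (q(1+|t|))^{1/6+ε}` [PetrowYoung2023, Thm 1.1] (Burgess:
`q^{3/16+ε}` [IwaniecKowalski2004, Thm 12.9]) — to be carried as an explicit hypothesis binder and
never declared as a `Prop`. Accordingly this file proves, with NO new definition and NO new fact:

* `Skeleton.lemma32_holds_of_halfLineBound` — for any `0 ≤ μ < ¼`, `b`, `C₀`: if every primitive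
  character `θ` to every modulus `q` satisfies `‖L(s,θ)‖ ≤ C₀ q^μ (1+|im s|)^b` on `re s = ½`
  (the tree's binder `Lemma32Subconvex.HalfLineBound θ μ b C₀`), then `Skeleton.Lemma32`;
* `Skeleton.lemma32_holds_of_subconvexity` — the same from the F-15 binder in the printed shape
  of [PetrowYoung2023, Thm 1.1]: `‖L(s,θ)‖ ≤ C (q(1+|im s|))^{1/6+ε}` on `re s = ½`, `0 ≤ ε < 1/12`
  `-- FACT F-15 (hypothesis form)`;
* `Skeleton.lemma32_holds_of_burgess` — the same from the Burgess shape of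
  [IwaniecKowalski2004, Thm 12.9]: `‖L(s,θ)‖ ≤ C‖s‖q^{3/16+ε}` on `re s = ½`, `0 ≤ ε < 1/16`
  (the tree's binder `Lemma32Subconvex.BurgessShape`) `-- FACT F-15 (hypothesis form)`.

So the node `Lemma32` is CLOSED MODULO F-15 (campaign GAP pointer G-ext-1): a CONDITIONAL
discharge, exactly as the charter prescribes for a class-H prerequisite; neither Burgess's nor
Petrow–Young's theorem is a theorem of Mathlib or of this tree, and neither is asserted here. The
unconditional détour (Lemma 3.6 without Lemma 3.2, `Section3Lemma36Input`) is a different lane.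
No statement about Theorems 1–2 of the source, or about Landau–Siegel zeros, is made or implied.

## References

* Y. Zhang, arXiv:2211.02515v1 (2022), §3 Lemma 3.2, p. 13. [cite: Zhang2022LandauSiegel, §3 Lemma 3.2 p.13]
* I. Petrow, M. P. Young, *The fourth moment of Dirichlet L-functions along a coset and the Weyl
  bound*, Duke Math. J. 172 (2023), Thm 1.1. [cite: PetrowYoung2023, Thm 1.1]
* H. Iwaniec, E. Kowalski, *Analytic Number Theory* (2004), Thm 12.9 (Burgess).
  [cite: IwaniecKowalski2004, Thm 12.9]
-/

noncomputable section

open Complex Real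

namespace Literature.NumberTheory.LFunctions.Zhang2022.Skeleton

open Literature.NumberTheory.LFunctions.Zhang2022.Lemma32Subconvex
  (HalfLineBound BurgessShape lemma_3_2_of_halfLineBound halfLineBound_of_burgessShape)

/-- `log D ≥ 3` once `D ≥ ⌈e³⌉`. [folklore] -/
private theorem three_le_log_of_le {D : ℕ} (hD : ⌈Real.exp 3⌉₊ ≤ D) : 3 ≤ Real.log D := by
  have h : Real.exp 3 ≤ D := le_trans (Nat.le_ceil _) (by exact_mod_cast hD)
  exact (Real.le_log_iff_exp_le (lt_of_lt_of_le (Real.exp_pos _) h)).mpr h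

/-- A critical-line bound with constant `C₀` implies the same bound with any larger constant.
[folklore] -/
private theorem halfLineBound_mono {q : ℕ} [NeZero q] (θ : DirichletCharacter ℂ q) {μ : ℝ}
    {b : ℕ} {C₀ C₁ : ℝ} (hC : C₀ ≤ C₁) (h : HalfLineBound θ μ b C₀) : HalfLineBound θ μ b C₁ := by
  intro s hs
  have hq : 0 ≤ (q : ℝ) ^ μ := Real.rpow_nonneg (Nat.cast_nonneg q) _
  have ht : 0 ≤ (1 + |s.im|) ^ b := by positivity
  calc ‖θ.LFunction s‖ ≤ C₀ * (q : ℝ) ^ μ * (1 + |s.im|) ^ b := h s hs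
    _ ≤ C₁ * (q : ℝ) ^ μ * (1 + |s.im|) ^ b := by gcongr

/-- **Lemma 3.2 of the manuscript (node `Skeleton.Lemma32`, DAG `Z22:Lem3.2`) DISCHARGED MODULO a
critical-line size bound of conductor exponent `μ < ¼`** [Z22 p.13, Lemma 3.2, tex L757–L777]:
if, for some `0 ≤ μ < ¼`, `b : ℕ` and `C₀`, every primitive Dirichlet character `θ` to every
modulus `q ≥ 1` satisfies `‖L(s,θ)‖ ≤ C₀ · q^μ · (1+|im s|)^b` for all `s` with `re s = ½` (the
tree's hypothesis schema `Lemma32Subconvex.HalfLineBound θ μ b C₀` — a binder, never an axiom;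
published instances: Burgess `μ = 3/16+ε` [cite: IwaniecKowalski2004, Thm 12.9], Weyl strength
`μ = 1/6+ε` [cite: PetrowYoung2023, Thm 1.1]; campaign FACT F-15, hypothesis form), then the node
holds: there is `C` such that for all large `D` and every real primitive `χ (mod D)` satisfying (A),
`Σ_{D⁴<n≤D⁸} |ν(n)|²τ₂(n)²/n ≤ C𝓛⁻²⁰⁰⁷`. Proof: the tree theorem
`Lemma32Subconvex.lemma_3_2_of_halfLineBound` (printed Lemma 3.2 under (A) and the bound, via the
contour shift of `Section3Lemma32Conditional` and Rademacher–Phragmén–Lindelöf) at `N = D⁸`, with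
`Skeleton.nu χ = divisorSumChar χ`, `𝓛 = log D`, and (A) typed with the printed strict `<`.
A CONDITIONAL discharge; nothing about Theorems 1–2 of the source.
[cite: Zhang2022LandauSiegel, §3 Lemma 3.2 p.13] -/
theorem lemma32_holds_of_halfLineBound {μ : ℝ} (hμ0 : 0 ≤ μ) (hμ : μ < 1 / 4) (b : ℕ) {C₀ : ℝ}
    (hF : ∀ (q : ℕ) [NeZero q] (θ : DirichletCharacter ℂ q), θ.IsPrimitive →
      HalfLineBound θ μ b C₀) :
    Lemma32 := by
  -- enlarge the constant to a positive one
  have hF' : ∀ (q : ℕ) [NeZero q] (θ : DirichletCharacter ℂ q), θ.IsPrimitive →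
      HalfLineBound θ μ b (max C₀ 1) :=
    fun q _ θ hθ => halfLineBound_mono θ (le_max_left _ _) (hF q θ hθ)
  have hC₀ : 0 < max C₀ 1 := lt_of_lt_of_le zero_lt_one (le_max_right _ _)
  obtain ⟨C, hC⟩ := lemma_3_2_of_halfLineBound hμ0 hμ b hC₀
  refine ⟨C, ⌈Real.exp 3⌉₊, fun D _ χ hD hq hp hA => ?_⟩
  have hlog : 3 ≤ Real.log D := three_le_log_of_le hD
  have hA' : ‖χ.LFunction 1‖ ≤ 1 / Real.log D ^ 2022 := le_of_lt hA
  have hN : ((D ^ 8 : ℕ) : ℝ) ≤ (D : ℝ) ^ 8 := by push_cast; exact le_rfl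
  have h := hC D χ hp hq.sq_eq_one hlog hA' (hF' D χ hp) (D ^ 8) hN
  simpa [nu, ell] using h

/-- **Lemma 3.2 of the manuscript (node `Skeleton.Lemma32`, DAG `Z22:Lem3.2`) DISCHARGED MODULO
FACT F-15 in the printed shape of the Weyl-strength subconvexity bound**
[Z22 p.13, Lemma 3.2, tex L757–L777]: if, for some `0 ≤ ε < 1/12` and `C`, every primitive
Dirichlet character `θ` to every modulus `q ≥ 1` satisfies
`‖L(s,θ)‖ ≤ C · (q · (1+|im s|))^{1/6+ε}` for all `s` with `re s = ½`
-- FACT F-15 (hypothesis form): "`L(½+it,χ) ≪_ε (q(1+|t|))^{1/6+ε}`" [cite: PetrowYoung2023, Thm 1.1],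
a HYPOTHESIS BINDER, not a theorem of Mathlib or of this tree, not asserted here —
then `Skeleton.Lemma32` holds (`Σ_{D⁴<n≤D⁸} |ν(n)|²τ₂(n)²/n ≤ C'𝓛⁻²⁰⁰⁷` under (A) for all large
`D`). Reduction to `lemma32_holds_of_halfLineBound` with `μ = 1/6 + ε < ¼`, `b = 1`
(`(1+|t|)^{1/6+ε} ≤ 1+|t|`). A CONDITIONAL discharge (campaign GAP pointer G-ext-1); nothing about
Theorems 1–2 of the source. [cite: Zhang2022LandauSiegel, §3 Lemma 3.2 p.13] -/
theorem lemma32_holds_of_subconvexity {ε C : ℝ} (hε0 : 0 ≤ ε) (hε : ε < 1 / 12)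
    (hF : ∀ (q : ℕ) [NeZero q] (θ : DirichletCharacter ℂ q), θ.IsPrimitive →
      ∀ s : ℂ, s.re = 1 / 2 →
        ‖θ.LFunction s‖ ≤ C * ((q : ℝ) * (1 + |s.im|)) ^ (1 / 6 + ε)) :
    Lemma32 := by
  refine lemma32_holds_of_halfLineBound (μ := 1 / 6 + ε) (by linarith) (by linarith) 1
    (C₀ := max C 0) fun q _ θ hθ s hs => ?_
  have hq0 : 0 ≤ (q : ℝ) := Nat.cast_nonneg q
  have ht1 : 1 ≤ 1 + |s.im| := le_add_of_nonneg_right (abs_nonneg _)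
  have ht0 : 0 ≤ 1 + |s.im| := le_trans zero_le_one ht1
  have hexp : (1 / 6 + ε : ℝ) ≤ 1 := by linarith
  -- `(q(1+|t|))^{1/6+ε} = q^{1/6+ε} (1+|t|)^{1/6+ε} ≤ q^{1/6+ε} (1+|t|)`
  have hsplit : ((q : ℝ) * (1 + |s.im|)) ^ (1 / 6 + ε) =
      (q : ℝ) ^ (1 / 6 + ε) * (1 + |s.im|) ^ (1 / 6 + ε) := Real.mul_rpow hq0 ht0
  have hpow : (1 + |s.im|) ^ (1 / 6 + ε) ≤ (1 + |s.im|) ^ (1 : ℕ) := by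
    rw [pow_one]
    calc (1 + |s.im|) ^ (1 / 6 + ε) ≤ (1 + |s.im|) ^ (1 : ℝ) :=
          Real.rpow_le_rpow_of_exponent_le ht1 hexp
      _ = 1 + |s.im| := Real.rpow_one _
  have hqμ : 0 ≤ (q : ℝ) ^ (1 / 6 + ε) := Real.rpow_nonneg hq0 _
  calc ‖θ.LFunction s‖ ≤ C * ((q : ℝ) * (1 + |s.im|)) ^ (1 / 6 + ε) := hF q θ hθ s hs
    _ ≤ max C 0 * ((q : ℝ) * (1 + |s.im|)) ^ (1 / 6 + ε) :=
        mul_le_mul_of_nonneg_right (le_max_left _ _) (Real.rpow_nonneg (mul_nonneg hq0 ht0) _)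
    _ = max C 0 * (q : ℝ) ^ (1 / 6 + ε) * (1 + |s.im|) ^ (1 / 6 + ε) := by rw [hsplit, mul_assoc]
    _ ≤ max C 0 * (q : ℝ) ^ (1 / 6 + ε) * (1 + |s.im|) ^ (1 : ℕ) :=
        mul_le_mul_of_nonneg_left hpow (mul_nonneg (le_max_right _ _) hqμ)

/-- **Lemma 3.2 of the manuscript (node `Skeleton.Lemma32`, DAG `Z22:Lem3.2`) DISCHARGED MODULO
FACT F-15 in the printed shape of Burgess's bound** [Z22 p.13, Lemma 3.2, tex L757–L777]: if, for
some `0 ≤ ε < 1/16` and `C`, every primitive Dirichlet character `θ` to every modulus `q ≥ 1`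
satisfies `‖L(s,θ)‖ ≤ C‖s‖q^{3/16+ε}` for all `s` with `re s = ½` (the tree's binder
`Lemma32Subconvex.BurgessShape θ ε C`)
-- FACT F-15 (hypothesis form): "`L(s,χ) ≪ |s| q^{3/16+ε}`, `χ` primitive mod `q > 2`, `re s = ½`"
[cite: IwaniecKowalski2004, Thm 12.9], a HYPOTHESIS BINDER, not a theorem of Mathlib or of this
tree, not asserted here — then `Skeleton.Lemma32` holds. Reduction to
`lemma32_holds_of_halfLineBound` with `μ = 3/16 + ε < ¼`, `b = 1`, through the tree's
`Lemma32Subconvex.halfLineBound_of_burgessShape`. A CONDITIONAL discharge (campaign GAP pointer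
G-ext-1); nothing about Theorems 1–2 of the source. [cite: Zhang2022LandauSiegel, §3 Lemma 3.2 p.13] -/
theorem lemma32_holds_of_burgess {ε C : ℝ} (hε0 : 0 ≤ ε) (hε : ε < 1 / 16)
    (hF : ∀ (q : ℕ) [NeZero q] (θ : DirichletCharacter ℂ q), θ.IsPrimitive → BurgessShape θ ε C) :
    Lemma32 := by
  refine lemma32_holds_of_halfLineBound (μ := 3 / 16 + ε) (by linarith) (by linarith) 1
    (C₀ := max C 0) fun q _ θ hθ => ?_
  refine halfLineBound_of_burgessShape θ (le_max_right _ _) fun s hs => ?_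
  have h0 : 0 ≤ ‖s‖ * (q : ℝ) ^ (3 / 16 + ε) :=
    mul_nonneg (norm_nonneg _) (Real.rpow_nonneg (Nat.cast_nonneg q) _)
  calc ‖θ.LFunction s‖ ≤ C * ‖s‖ * (q : ℝ) ^ (3 / 16 + ε) := hF q θ hθ s hs
    _ = C * (‖s‖ * (q : ℝ) ^ (3 / 16 + ε)) := by ring
    _ ≤ max C 0 * (‖s‖ * (q : ℝ) ^ (3 / 16 + ε)) := mul_le_mul_of_nonneg_right (le_max_left _ _) h0
    _ = max C 0 * ‖s‖ * (q : ℝ) ^ (3 / 16 + ε) := by ring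

end Literature.NumberTheory.LFunctions.Zhang2022.Skeleton

end
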